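import Literature.NumberTheory.Weil1964.AdelicSiegelParabolicLift
import Literature.NumberTheory.Weil1964.AdelicDoublingOriginValueInvariance
import Literature.NumberTheory.Weil1964.AdelicMetaplecticRationalLiftIsometric
import Literature.NumberTheory.Weil1964.AdelicDoublingDefectCharacterTrivial
import Literature.NumberTheory.Weil1964.AdelicMetaplecticKernel
import HarnessLib

/-!
# The modulus of the Siegel–Weil section at the origin: `‖(ω(q)Φ)(0)‖` over the adelic Siegel parabolic

Topic `NumberTheory/Weil1964`; namespace `Literature.NumberTheory.Weil1964`.  KERNEL ONLY: theorems, no definition, nothing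
of [Weil1964] ∕ [Weil1965] asserted; no Literature fact is introduced or consumed.  Origin: cell `hodgecm-mathlib`, programme P4,
engine E-2 (Rallis inner product formula, rank-one slice), Siegel–Weil sub-line SW2a piece (2) «MAJ» (F0P4-plan (g3) ruling
2026-08-31T01:35:36Z (1) on the census `CENSUS-MAJ-SiegelSectionModulus.A-p12g12.md`); `--supports stmt-HodgeConjecture-24833`.
HC_CM is proved only modulo the printed citations until rung 0 closes; this file discharges none of them.

In print ([Weil1965, n° 39 (30)–(31)]; [Kudla1994, §3]) the Siegel–Weil section `f_Φ(g) = (ω(g)Φ)(0)` satisfies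
`f_Φ(p g) = χ(p)|a(p)|^{m/2} f_Φ(g)` on the Siegel parabolic `P = M N`, because the Weil representation is normalised to be UNITARY
(`ω(m(a))Φ(x) = |det a|^{1/2} Φ(x a)`).  The tree's metaplectic group of record `Mp_ψ(W_𝔸)ᶜᵒⁿᵗ = adelicMpCont F (Fin n) T` is the
`ℂˣ`-extension (operators NOT normalised, `AdelicMetaplecticKernel`), and its Siegel lift `𝐫₀ = adelicSiegelLiftCont` carries NO
modulus: `(ω(𝐫₀ p)Φ)(x) = ψ(…) Φ(a_p⁻¹ x)` (`coe_toOp_adelicSiegelLift`).  The modulus character re-enters through the `L²(ν)` scaling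
`l2Scaling` (`AdelicMetaplecticUnitaryLegContinuity` §2, `AdelicMetaplecticL2Scalar`): this file proves, for `T ∈ GL_n(𝔸_F)` and any
additive Haar measure `ν` on `𝔸_Fⁿ`,

* (input, ★ `AdelicDoublingOriginValueInvariance.omega_adelicSiegelLiftCont_apply_zero`, A-p17 (g13)) `(ω(𝐫₀ p)Φ)(0) = Φ(0)` for
  `p ∈ P_Y(𝔸)` (`𝐫₀` is the `δ₀`-fixing lift);
* `exists_eq_ofScalar_mul_adelicSiegelLiftCont` — every `q ∈ Mp_ψ(W_𝔸)ᶜᵒⁿᵗ` over `p ∈ P_Y(𝔸)` is `q = (1, c·id) · 𝐫₀ p`, `c ∈ ℂˣ`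
  (exactness `1 → ℂˣ → Mpᶜᵒⁿᵗ → Sp`, `adelicMpCont.exists_eq_ofScalar_of_proj_eq_one`);
* `l2Scaling_adelicSiegelLiftCont` — `l2Scaling ν (𝐫₀ p) = |det a_p|_𝔸` (stated as `adelicAbsDet (trInv a_p)⁻¹`, the module of the
  row-vector twist by `(a_p⁻¹)ᵀ`; the unipotent pair is isometric);
* **`norm_sq_omega_apply_zero_of_proj_eq`** (MAJ-P) — for every `q` over `p ∈ P_Y(𝔸)` and every `Φ ∈ 𝒮(𝔸_Fⁿ)`:
  `‖(ω(q)Φ)(0)‖² = l2Scaling ν q · |det a_p|_𝔸⁻¹ · ‖Φ(0)‖²` — the tree's form of `|f_Φ(p)| = |a(p)|^{-m/2}|Φ(0)|` for the unitary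
  normalisation (`(ω(q)Φ)(x) = c·ψ(…)Φ(a_p⁻¹x)` with `|c|²|det a_p|_𝔸 = l2Scaling q`): the section is `P(𝔸)`-equivariant with the
  modulus read through the `L²` scaling of the chosen lift;
* `norm_sq_omega_apply_zero_of_mul_of_l2Scaling` — for an `L²`-ISOMETRIC `g = q · r` (`l2Scaling ν g = 1`; e.g. Weil's `r_F γ`,
  ★ `adelicMpCont.l2Scaling_ratThetaLiftCont`) with `q` over `p ∈ P_Y(𝔸)`:
  `‖(ω(g)Φ)(0)‖² = (l2Scaling ν r)⁻¹ · |det a_p|_𝔸⁻¹ · ‖(ω(r)Φ)(0)‖²` — the majorant shape `|f(p k)| = |a(p)|^{-m/2} N_Φ(k)` with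
  `N_Φ(r)² = (l2Scaling r)⁻¹‖(ω(r)Φ)(0)‖²` BLIND to the central `ℂˣ` (`N_Φ((1,c) r) = N_Φ(r)`), and its instance
  `norm_sq_omega_ratThetaLiftCont_apply_zero` for `g = r_F γ`.

## References
* [Weil1964] A. Weil, Acta Math. 111 (1964), Chap. I n° 13 p. 160 (the operators `d₀(λ)`, `t₀(f)` of the Siegel parabolic).
* [Weil1965] A. Weil, Acta Math. 113 (1965), n° 39 (30)–(31) p. 62 (the section `Φ ↦ (r(s)Φ)(0)` and its `P`-equivariance).
* [Kudla1994] S. Kudla, Israel J. Math. 87 (1994), §3 p. 378 (`Φ(g) = ω(g)φ(0) ∈ I(s₀)`).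
-/

set_option autoImplicit false

noncomputable section

open scoped Matrix NNReal ENNReal

namespace Literature.NumberTheory.Weil1964

open NumberField _root_.MeasureTheory Literature.NumberTheory.Automorphic Literature.RepresentationTheory.HeisenbergGroup

section Algebra

variable (F : Type) [Field F] [NumberField F] {n : ℕ}
variable (T : Matrix (Fin n) (Fin n) (AdeleRing (𝓞 F) F)) (hT : IsUnit T.det)

/-- `(ω(a b)Φ)(x) = (ω(a)(ω(b)Φ))(x)` on underlying functions (term-mode transport of `map_mul`; stated on atoms so that
consumers never rewrite inside the operator terms): `ω_ψ` is a homomorphism. [cite: GelbartRogawski1991, §3.1 p. 454] -/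
theorem coe_omega_mul_apply (a b : adelicMpCont F (Fin n) T) (Φ : piSchwartzBruhat F (Fin n)) (x : Fin n → AdeleRing (𝓞 F) F) :
    ((adelicMpCont.omega F (Fin n) T (a * b) Φ : piSchwartzBruhat F (Fin n)) : (Fin n → AdeleRing (𝓞 F) F) → ℂ) x =
      ((adelicMpCont.omega F (Fin n) T a (adelicMpCont.omega F (Fin n) T b Φ) : piSchwartzBruhat F (Fin n)) :
        (Fin n → AdeleRing (𝓞 F) F) → ℂ) x :=
  congrArg (fun Ψ : piSchwartzBruhat F (Fin n) => (Ψ : (Fin n → AdeleRing (𝓞 F) F) → ℂ) x)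
    (LinearMap.congr_fun (map_mul (adelicMpCont.omega F (Fin n) T) a b) Φ)

/-- `(ω((1, c·id) · r)Φ)(x) = c · (ω(r)Φ)(x)`. [cite: GelbartRogawski1991, §3.1 p. 454] -/
theorem coe_omega_ofScalar_mul_apply (c : ℂˣ) (r : adelicMpCont F (Fin n) T) (Φ : piSchwartzBruhat F (Fin n))
    (x : Fin n → AdeleRing (𝓞 F) F) :
    ((adelicMpCont.omega F (Fin n) T (adelicMpCont.ofScalar F (Fin n) T c * r) Φ : piSchwartzBruhat F (Fin n)) :
        (Fin n → AdeleRing (𝓞 F) F) → ℂ) x =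
      (c : ℂ) * ((adelicMpCont.omega F (Fin n) T r Φ : piSchwartzBruhat F (Fin n)) : (Fin n → AdeleRing (𝓞 F) F) → ℂ) x :=
  (coe_omega_mul_apply F T (adelicMpCont.ofScalar F (Fin n) T c) r Φ x).trans
    (congrArg (fun Ψ : piSchwartzBruhat F (Fin n) => (Ψ : (Fin n → AdeleRing (𝓞 F) F) → ℂ) x)
      (adelicMpCont.omega_ofScalar c (adelicMpCont.omega F (Fin n) T r Φ)))

/-- `q · 𝐫₀(p)⁻¹` lies over `1` when `q` lies over `p ∈ P_Y(𝔸)`. [cite: Weil1964, Chap. I n° 13 p. 160] -/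
theorem proj_mul_inv_adelicSiegelLiftCont (q : adelicMpCont F (Fin n) T) (p : siegelParabolicPi T)
    (hq : adelicMpCont.proj F (Fin n) T q = (p : symplecticGroup (polar (adelicForm F (Fin n) T)))) :
    adelicMpCont.proj F (Fin n) T (q * (adelicSiegelLiftCont F T hT p)⁻¹) = 1 :=
  (map_mul (adelicMpCont.proj F (Fin n) T) q (adelicSiegelLiftCont F T hT p)⁻¹).trans
    ((congrArg₂ (fun a b => a * b) hq
      ((map_inv (adelicMpCont.proj F (Fin n) T) (adelicSiegelLiftCont F T hT p)).trans
        (congrArg (fun b => b⁻¹) (proj_adelicSiegelLiftCont F T hT p)))).trans (mul_inv_cancel _))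

include hT in
/-- `q · 𝐫₀(p)⁻¹ = (1, c·id)` for some `c ∈ ℂˣ` (exactness `1 → ℂˣ → Mpᶜᵒⁿᵗ → Sp` at the middle term,
`adelicMpCont.exists_eq_ofScalar_of_proj_eq_one`). [cite: GelbartRogawski1991, §3.1 p. 454 L21–33] -/
theorem exists_mul_inv_adelicSiegelLiftCont_eq_ofScalar (q : adelicMpCont F (Fin n) T) (p : siegelParabolicPi T)
    (hq : adelicMpCont.proj F (Fin n) T q = (p : symplecticGroup (polar (adelicForm F (Fin n) T)))) :
    ∃ c : ℂˣ, q * (adelicSiegelLiftCont F T hT p)⁻¹ = adelicMpCont.ofScalar F (Fin n) T c :=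
  adelicMpCont.exists_eq_ofScalar_of_proj_eq_one ((Matrix.isUnit_iff_isUnit_det T).2 hT) _
    (proj_mul_inv_adelicSiegelLiftCont F T hT q p hq)

include hT in
/-- **exactness over the Siegel parabolic**: an element `q ∈ Mp_ψ(W_𝔸)ᶜᵒⁿᵗ` over `p ∈ P_Y(𝔸)` is `(1, c·id) · 𝐫₀(p)` for some
`c ∈ ℂˣ`. [cite: Weil1964, Chap. I n° 13 p. 160] [cite: GelbartRogawski1991, §3.1 p. 454 L21–33] -/
theorem exists_eq_ofScalar_mul_adelicSiegelLiftCont (q : adelicMpCont F (Fin n) T) (p : siegelParabolicPi T)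
    (hq : adelicMpCont.proj F (Fin n) T q = (p : symplecticGroup (polar (adelicForm F (Fin n) T)))) :
    ∃ c : ℂˣ, q = adelicMpCont.ofScalar F (Fin n) T c * adelicSiegelLiftCont F T hT p :=
  (exists_mul_inv_adelicSiegelLiftCont_eq_ofScalar F T hT q p hq).imp fun _ hc => mul_inv_eq_iff_eq_mul.1 hc

end Algebra

section Modulus

variable (F : Type) [Field F] [NumberField F] {n : ℕ}
variable (T : Matrix (Fin n) (Fin n) (AdeleRing (𝓞 F) F)) (hT : IsUnit T.det)
variable [MeasurableSpace (AdeleRing (𝓞 F) F)] [BorelSpace (AdeleRing (𝓞 F) F)]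
  (ν : Measure (Fin n → AdeleRing (𝓞 F) F)) [ν.IsAddHaarMeasure]

include hT in
/-- **the `L²` scaling of `𝐫₀(p)`**: `l2Scaling ν (𝐫₀ p) = |det a_p|_𝔸`, in the tree's spelling `adelicAbsDet (trInv a_p)⁻¹` —
`𝐫₀ p = leviPair a_p · unipPair c_p`, the Levi pair is the row-vector twist by `(a_p⁻¹)ᵀ` (`l2Scaling_leviPair`) and the unipotent
pair is a unimodular multiplier (`l2Scaling_unipPair`). [cite: Weil1964, Chap. I n° 13 p. 160] -/
theorem l2Scaling_adelicSiegelLiftCont (p : siegelParabolicPi T) :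
    adelicMpCont.l2Scaling F T hT ν (adelicSiegelLiftCont F T hT p) =
      ((adelicAbsDet n F (trInv (SiegelParabolicPi.aGL p.2))⁻¹ : ℝ≥0) : ℝ≥0∞) :=
  have h : adelicSiegelLiftCont F T hT p =
      (⟨leviPair F T hT (SiegelParabolicPi.aGL p.2), leviPair_mem_adelicMpCont F T hT _⟩ : adelicMpCont F (Fin n) T) *
        ⟨unipPair F T hT (SiegelParabolicPi.cMat (p : symplecticGroup (polar (adelicForm F (Fin n) T)))) (SiegelParabolicPi.cMat_isSymm _),
          unipPair_mem_adelicMpCont F T hT _ _⟩ :=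
    Subtype.ext (adelicSiegelLift_eq_leviPair_mul_unipPair F T hT p)
  ((congrArg (adelicMpCont.l2Scaling F T hT ν) h).trans (adelicMpCont.l2Scaling_mul F T hT ν _ _)).trans
    ((congrArg₂ (fun a b => a * b) (adelicMpCont.l2Scaling_leviPair F T hT ν (SiegelParabolicPi.aGL p.2))
      (adelicMpCont.l2Scaling_unipPair F T hT ν _ (SiegelParabolicPi.cMat_isSymm _))).trans (mul_one _))

/-- scalar bookkeeping on atoms: `A = c B`, `L = ‖c‖² D`, `D ≠ 0` ⇒ `‖A‖² = L D⁻¹ ‖B‖²`. [folklore] -/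
private theorem norm_sq_eq_of_eq_mul {A B c : ℂ} {L D : ℝ} (hval : A = c * B) (hL : L = ‖c‖ ^ 2 * D) (hD : D ≠ 0) :
    ‖A‖ ^ 2 = L * D⁻¹ * ‖B‖ ^ 2 := by
  rw [hval, norm_mul, mul_pow, hL, mul_inv_cancel_right₀ hD]

/-- `(l2Scaling ((1,c) · x)).toReal = ‖c‖² · (l2Scaling x).toReal` (read in `ℝ`). [cite: Weil1964, Chap. I n° 13 p. 160] -/
private theorem toReal_l2Scaling_ofScalar_mul (c : ℂˣ) (x : adelicMpCont F (Fin n) T) :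
    (adelicMpCont.l2Scaling F T hT ν (adelicMpCont.ofScalar F (Fin n) T c * x)).toReal =
      ‖(c : ℂ)‖ ^ 2 * (adelicMpCont.l2Scaling F T hT ν x).toReal :=
  ((congrArg ENNReal.toReal (adelicMpCont.l2Scaling_mul F T hT ν _ x)).trans ENNReal.toReal_mul).trans
    (congrArg (fun t => t * (adelicMpCont.l2Scaling F T hT ν x).toReal)
      (((congrArg ENNReal.toReal (l2Scaling_ofScalar F T hT ν c)).trans (ENNReal.toReal_pow _ 2)).trans
        (congrArg (fun t => t ^ 2) (toReal_enorm (c : ℂ)))))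

include hT in
/-- **(MAJ-P) THE MODULUS OF THE SECTION OVER THE SIEGEL PARABOLIC**: for every `q ∈ Mp_ψ(W_𝔸)ᶜᵒⁿᵗ` over `p ∈ P_Y(𝔸)` and every
`Φ ∈ 𝒮(𝔸_Fⁿ)`, `‖(ω(q)Φ)(0)‖² = l2Scaling ν q · |det a_p|_𝔸⁻¹ · ‖Φ(0)‖²` (`|det a_p|_𝔸 = adelicAbsDet (trInv a_p)⁻¹`) — print's
`|f_Φ(p)| = |a(p)|^{∓m/2} |Φ(0)|` for the unitary normalisation (`l2Scaling = 1`), read in the tree's `ℂˣ`-extension through the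
`L²` scaling of the chosen lift `q` (`q = (1, c) 𝐫₀ p`, `(ω(q)Φ)(0) = c Φ(0)`, `l2Scaling q = |c|² |det a_p|_𝔸`).
[cite: Weil1965, n° 39 (30)–(31) p. 62] [cite: Kudla1994, §3 p. 378] -/
theorem norm_sq_omega_apply_zero_of_proj_eq (q : adelicMpCont F (Fin n) T) (p : siegelParabolicPi T)
    (hq : adelicMpCont.proj F (Fin n) T q = (p : symplecticGroup (polar (adelicForm F (Fin n) T)))) (Φ : piSchwartzBruhat F (Fin n)) :
    ‖((adelicMpCont.omega F (Fin n) T q Φ : piSchwartzBruhat F (Fin n)) : (Fin n → AdeleRing (𝓞 F) F) → ℂ) 0‖ ^ 2 =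
      (adelicMpCont.l2Scaling F T hT ν q).toReal * ((adelicAbsDet n F (trInv (SiegelParabolicPi.aGL p.2))⁻¹ : ℝ≥0) : ℝ)⁻¹ *
        ‖(Φ : (Fin n → AdeleRing (𝓞 F) F) → ℂ) 0‖ ^ 2 := by
  obtain ⟨c, rfl⟩ := exists_eq_ofScalar_mul_adelicSiegelLiftCont F T hT q p hq
  exact norm_sq_eq_of_eq_mul
    ((coe_omega_ofScalar_mul_apply F T c (adelicSiegelLiftCont F T hT p) Φ 0).trans
      (congrArg (fun z => (c : ℂ) * z) (omega_adelicSiegelLiftCont_apply_zero F T hT p Φ)))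
    ((toReal_l2Scaling_ofScalar_mul F T hT ν c _).trans
      (congrArg (fun t => ‖(c : ℂ)‖ ^ 2 * t)
        ((congrArg ENNReal.toReal (l2Scaling_adelicSiegelLiftCont F T hT ν p)).trans (ENNReal.coe_toReal _))))
    (NNReal.coe_ne_zero.2 ((Group.isUnit _).map (adelicAbsDet n F)).ne_zero)

/-- scalar bookkeeping on atoms: `X² = Lq D⁻¹ Y²`, `Lq Lr = 1` ⇒ `X² = Lr⁻¹ D⁻¹ Y²`. [folklore] -/
private theorem sq_eq_of_mul_eq_one {X Y Lq Lr D : ℝ} (h : X ^ 2 = Lq * D⁻¹ * Y ^ 2) (hm : Lq * Lr = 1) :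
    X ^ 2 = Lr⁻¹ * D⁻¹ * Y ^ 2 := by
  rw [h, eq_inv_of_mul_eq_one_left hm]

include hT in
/-- **THE MAJORANT SHAPE `|f_Φ(p k)| = |a(p)|^{∓m/2} · N_Φ(k)` FOR AN ISOMETRIC ELEMENT**: if `g = q · r` has `l2Scaling ν g = 1` and
`q` lies over `p ∈ P_Y(𝔸)`, then `‖(ω(g)Φ)(0)‖² = (l2Scaling ν r)⁻¹ · |det a_p|_𝔸⁻¹ · ‖(ω(r)Φ)(0)‖²`; the factor
`N_Φ(r)² = (l2Scaling ν r)⁻¹ ‖(ω(r)Φ)(0)‖²` is unchanged under `r ↦ (1, c·id) · r` — the majorant is blind to the central `ℂˣ`.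
[cite: Weil1965, n° 39 (30)–(31) p. 62] -/
theorem norm_sq_omega_apply_zero_of_mul_of_l2Scaling {g q r : adelicMpCont F (Fin n) T} (hg : g = q * r)
    (h1 : adelicMpCont.l2Scaling F T hT ν g = 1) (p : siegelParabolicPi T)
    (hq : adelicMpCont.proj F (Fin n) T q = (p : symplecticGroup (polar (adelicForm F (Fin n) T)))) (Φ : piSchwartzBruhat F (Fin n)) :
    ‖((adelicMpCont.omega F (Fin n) T g Φ : piSchwartzBruhat F (Fin n)) : (Fin n → AdeleRing (𝓞 F) F) → ℂ) 0‖ ^ 2 =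
      (adelicMpCont.l2Scaling F T hT ν r).toReal⁻¹ * ((adelicAbsDet n F (trInv (SiegelParabolicPi.aGL p.2))⁻¹ : ℝ≥0) : ℝ)⁻¹ *
        ‖((adelicMpCont.omega F (Fin n) T r Φ : piSchwartzBruhat F (Fin n)) : (Fin n → AdeleRing (𝓞 F) F) → ℂ) 0‖ ^ 2 := by
  subst hg
  have hm : (adelicMpCont.l2Scaling F T hT ν q).toReal * (adelicMpCont.l2Scaling F T hT ν r).toReal = 1 :=
    ENNReal.toReal_mul.symm.trans
      ((congrArg ENNReal.toReal ((adelicMpCont.l2Scaling_mul F T hT ν q r).symm.trans h1)).trans ENNReal.toReal_one)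
  exact sq_eq_of_mul_eq_one
    ((congrArg (fun z : ℂ => ‖z‖ ^ 2) (coe_omega_mul_apply F T q r Φ 0)).trans
      (norm_sq_omega_apply_zero_of_proj_eq F T hT ν q p hq (adelicMpCont.omega F (Fin n) T r Φ))) hm

include hT in
/-- **Weil's `r_F(γ)` factored through the Siegel parabolic**: if `r_F γ = q · r` with `q` over `p ∈ P_Y(𝔸)` then
`‖(ω(r_F γ)Φ)(0)‖² = (l2Scaling ν r)⁻¹ · |det a_p|_𝔸⁻¹ · ‖(ω(r)Φ)(0)‖²` (`r_F` is `L²`-isometric,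
★ `adelicMpCont.l2Scaling_ratThetaLiftCont`). [cite: Weil1965, n° 39 (30)–(31) p. 62] [cite: Weil1964, Chap. III n° 40 p. 190] -/
theorem norm_sq_omega_ratThetaLiftCont_apply_zero (γ : Matrix.symplecticGroup (Fin n) F) {q r : adelicMpCont F (Fin n) T}
    (hg : ratThetaLiftCont F T hT γ = q * r) (p : siegelParabolicPi T)
    (hq : adelicMpCont.proj F (Fin n) T q = (p : symplecticGroup (polar (adelicForm F (Fin n) T)))) (Φ : piSchwartzBruhat F (Fin n)) :
    ‖((adelicMpCont.omega F (Fin n) T (ratThetaLiftCont F T hT γ) Φ : piSchwartzBruhat F (Fin n)) : (Fin n → AdeleRing (𝓞 F) F) → ℂ) 0‖ ^ 2 =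
      (adelicMpCont.l2Scaling F T hT ν r).toReal⁻¹ * ((adelicAbsDet n F (trInv (SiegelParabolicPi.aGL p.2))⁻¹ : ℝ≥0) : ℝ)⁻¹ *
        ‖((adelicMpCont.omega F (Fin n) T r Φ : piSchwartzBruhat F (Fin n)) : (Fin n → AdeleRing (𝓞 F) F) → ℂ) 0‖ ^ 2 :=
  norm_sq_omega_apply_zero_of_mul_of_l2Scaling F T hT ν hg (adelicMpCont.l2Scaling_ratThetaLiftCont F T hT ν γ) p hq Φ

end Modulus

end Literature.NumberTheory.Weil1964

end
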